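import Mathlib
import Summits.AtomisticToContinuum.HydrodynamicLimit.Theorems.ImplosionDichotomyDenseExcursionPackingAnalyticRadialPairs

/-!
# The sources of the hierarchy of `Γ` are centre-regular pairs
# (crux `DenseExcursion`, stmt-AtomisticToContinuum-12586, line `sonic-cavity-renewal` v7, stub `stub_analyticPackingImplosion`)

Helper file (`--supports stmt-AtomisticToContinuum-12586`, line lead a2, wave-3 worker D). With the radial description of
regular pairs (`isRegularPair_iff_radial`, `…PackingAnalyticRadialPairs`: a real pair `(u₁, u₂)` is centre-regular iff
`u₁(log ‖y‖)` and `‖y‖ u₂(log ‖y‖)` are smooth scalar fields on `ℝ³`), regularity of the sources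
`Src_k = (Src_w, Src_s)` of the order-`k` hierarchy `(kμ − L)X_k = Src_k` (`packingHierarchy_order`, stiffening
coefficients in the closed form of `familyCoeff_stiffening`) is the closure of the class
`𝓔 = {f | y ↦ f(log ‖y‖) is smooth on ℝ³}` (written out in full in every statement: no notation is declared) under
sums, products, `d/dx` and the division lemma `radialExt_div`:

* `packingSources_regular` (REGISTERED helper): if `(wc j, sc j)` is a regular pair for every `j < k` (order `0` being
  the profile `(W, S)` itself), then so is `(Src_w k, Src_s k)` — for ANY jet `m` of the stiffening law. The `w`-terms
  `wc i · wc j′`, `wc i · wc j` are products in `𝓔`; the pressure terms `sc i (sc j′ + sc j) = (eˣ sc i) · e^{−2x}(eˣ sc j)′`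
  are regular by the division lemma although `sc i · sc j ∼ e^{−2x}` alone is not; the stiffening coefficients
  `Mc c = Σ_j m_j e^{3jx} [G^{c−j}](Σ sc n Gⁿ)^{3j}` are polynomials in the `eˣ sc n ∈ 𝓔`; and
  `eˣ Src_s = Σ wc i (eˣ sc j′) + (eˣ sc i) wc j′/3 + 2 (eˣ sc i) wc j ∈ 𝓔`.

NOT here: the weighted sup bound of the sources (companion file), norms, or `Γ`.
-/

noncomputable section

open Set Filter Finset PowerSeries
open scoped Topology ContDiff

namespace Summit.AtomisticToContinuum.HydrodynamicLimit.Theorems.PackingAnalyticImplosion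

open Literature.MathematicalPhysics.KineticTheory (V3)
open Summit.AtomisticToContinuum.HydrodynamicLimit.Theorems.R2OneModeTwoConditions

/-! ## `𝓔` is an algebra stable under `d/dx`, with the division lemma -/

/-- Constants are in `𝓔`. [folklore] -/
theorem radial_const (c : ℝ) : (fun _ : ℝ => c) ∈ {f : ℝ → ℝ | ∃ Φ : V3 → ℝ, ContDiff ℝ ∞ Φ ∧ ∀ y : V3, y ≠ 0 → Φ y = f (Real.log ‖y‖)} := ⟨fun _ => c, contDiff_const, fun _ _ => rfl⟩

/-- `𝓔` is stable under sums. [folklore] -/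
theorem radial_add {f g : ℝ → ℝ} (hf : f ∈ {f : ℝ → ℝ | ∃ Φ : V3 → ℝ, ContDiff ℝ ∞ Φ ∧ ∀ y : V3, y ≠ 0 → Φ y = f (Real.log ‖y‖)})
    (hg : g ∈ {f : ℝ → ℝ | ∃ Φ : V3 → ℝ, ContDiff ℝ ∞ Φ ∧ ∀ y : V3, y ≠ 0 → Φ y = f (Real.log ‖y‖)}) :
    (fun x => f x + g x) ∈ {f : ℝ → ℝ | ∃ Φ : V3 → ℝ, ContDiff ℝ ∞ Φ ∧ ∀ y : V3, y ≠ 0 → Φ y = f (Real.log ‖y‖)} := by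
  obtain ⟨Φ, hΦ, hΦf⟩ := hf
  obtain ⟨Ψ, hΨ, hΨg⟩ := hg
  exact ⟨fun y => Φ y + Ψ y, hΦ.add hΨ, fun y hy => by simp only [hΦf y hy, hΨg y hy]⟩

/-- `𝓔` is stable under differences. [folklore] -/
theorem radial_sub {f g : ℝ → ℝ} (hf : f ∈ {f : ℝ → ℝ | ∃ Φ : V3 → ℝ, ContDiff ℝ ∞ Φ ∧ ∀ y : V3, y ≠ 0 → Φ y = f (Real.log ‖y‖)})
    (hg : g ∈ {f : ℝ → ℝ | ∃ Φ : V3 → ℝ, ContDiff ℝ ∞ Φ ∧ ∀ y : V3, y ≠ 0 → Φ y = f (Real.log ‖y‖)}) :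
    (fun x => f x - g x) ∈ {f : ℝ → ℝ | ∃ Φ : V3 → ℝ, ContDiff ℝ ∞ Φ ∧ ∀ y : V3, y ≠ 0 → Φ y = f (Real.log ‖y‖)} := by
  obtain ⟨Φ, hΦ, hΦf⟩ := hf
  obtain ⟨Ψ, hΨ, hΨg⟩ := hg
  exact ⟨fun y => Φ y - Ψ y, hΦ.sub hΨ, fun y hy => by simp only [hΦf y hy, hΨg y hy]⟩

/-- `𝓔` is stable under products. [folklore] -/
theorem radial_mul {f g : ℝ → ℝ} (hf : f ∈ {f : ℝ → ℝ | ∃ Φ : V3 → ℝ, ContDiff ℝ ∞ Φ ∧ ∀ y : V3, y ≠ 0 → Φ y = f (Real.log ‖y‖)})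
    (hg : g ∈ {f : ℝ → ℝ | ∃ Φ : V3 → ℝ, ContDiff ℝ ∞ Φ ∧ ∀ y : V3, y ≠ 0 → Φ y = f (Real.log ‖y‖)}) :
    (fun x => f x * g x) ∈ {f : ℝ → ℝ | ∃ Φ : V3 → ℝ, ContDiff ℝ ∞ Φ ∧ ∀ y : V3, y ≠ 0 → Φ y = f (Real.log ‖y‖)} := by
  obtain ⟨Φ, hΦ, hΦf⟩ := hf
  obtain ⟨Ψ, hΨ, hΨg⟩ := hg
  exact ⟨fun y => Φ y * Ψ y, hΦ.mul hΨ, fun y hy => by simp only [hΦf y hy, hΨg y hy]⟩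

/-- `𝓔` is stable under scalar multiples. [folklore] -/
theorem radial_const_mul (c : ℝ) {f : ℝ → ℝ} (hf : f ∈ {f : ℝ → ℝ | ∃ Φ : V3 → ℝ, ContDiff ℝ ∞ Φ ∧ ∀ y : V3, y ≠ 0 → Φ y = f (Real.log ‖y‖)}) :
    (fun x => c * f x) ∈ {f : ℝ → ℝ | ∃ Φ : V3 → ℝ, ContDiff ℝ ∞ Φ ∧ ∀ y : V3, y ≠ 0 → Φ y = f (Real.log ‖y‖)} :=
  radial_mul (radial_const c) hf

/-- `𝓔` is stable under finite sums. [folklore] -/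
theorem radial_sum {ι : Type*} (s : Finset ι) {g : ι → ℝ → ℝ} (hg : ∀ i ∈ s, g i ∈ {f : ℝ → ℝ | ∃ Φ : V3 → ℝ, ContDiff ℝ ∞ Φ ∧ ∀ y : V3, y ≠ 0 → Φ y = f (Real.log ‖y‖)}) :
    (fun x => ∑ i ∈ s, g i x) ∈ {f : ℝ → ℝ | ∃ Φ : V3 → ℝ, ContDiff ℝ ∞ Φ ∧ ∀ y : V3, y ≠ 0 → Φ y = f (Real.log ‖y‖)} := by
  classical
  induction s using Finset.induction_on with
  | empty => simpa using radial_const 0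
  | insert a s ha ih =>
    have h1 : g a ∈ {f : ℝ → ℝ | ∃ Φ : V3 → ℝ, ContDiff ℝ ∞ Φ ∧ ∀ y : V3, y ≠ 0 → Φ y = f (Real.log ‖y‖)} := hg a (Finset.mem_insert_self a s)
    have h2 : (fun x => ∑ i ∈ s, g i x) ∈ {f : ℝ → ℝ | ∃ Φ : V3 → ℝ, ContDiff ℝ ∞ Φ ∧ ∀ y : V3, y ≠ 0 → Φ y = f (Real.log ‖y‖)} := ih fun i hi => hg i (Finset.mem_insert_of_mem hi)
    have h := radial_add h1 h2
    have e : (fun x => ∑ i ∈ insert a s, g i x) = fun x => g a x + ∑ i ∈ s, g i x := by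
      funext x; rw [Finset.sum_insert ha]
    rw [e]; exact h

/-- Members of `𝓔` are smooth in `x`. [folklore] -/
theorem radial_smooth {f : ℝ → ℝ} (hf : f ∈ {f : ℝ → ℝ | ∃ Φ : V3 → ℝ, ContDiff ℝ ∞ Φ ∧ ∀ y : V3, y ≠ 0 → Φ y = f (Real.log ‖y‖)}) : ContDiff ℝ ∞ f := by
  obtain ⟨Φ, hΦ, hΦf⟩ := hf
  exact contDiff_of_radialExt hΦ hΦf

/-- `𝓔` is stable under `d/dx` (`radialExt_deriv`). [folklore] -/
theorem radial_deriv {f : ℝ → ℝ} (hf : f ∈ {f : ℝ → ℝ | ∃ Φ : V3 → ℝ, ContDiff ℝ ∞ Φ ∧ ∀ y : V3, y ≠ 0 → Φ y = f (Real.log ‖y‖)}) :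
    deriv f ∈ {f : ℝ → ℝ | ∃ Φ : V3 → ℝ, ContDiff ℝ ∞ Φ ∧ ∀ y : V3, y ≠ 0 → Φ y = f (Real.log ‖y‖)} := by
  obtain ⟨Φ, hΦ, hΦf⟩ := hf
  obtain ⟨h1, h2⟩ := radialExt_deriv hΦ hΦf
  exact ⟨fun y => fderiv ℝ Φ y y, h1, h2⟩

/-- THE DIVISION LEMMA in `𝓔`-form: `f ∈ 𝓔 ⇒ e^{−2x} f′ ∈ 𝓔` (`radialExt_div`). [folklore] -/
theorem radial_div {f : ℝ → ℝ} (hf : f ∈ {f : ℝ → ℝ | ∃ Φ : V3 → ℝ, ContDiff ℝ ∞ Φ ∧ ∀ y : V3, y ≠ 0 → Φ y = f (Real.log ‖y‖)}) :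
    (fun x => Real.exp (-2 * x) * deriv f x) ∈ {f : ℝ → ℝ | ∃ Φ : V3 → ℝ, ContDiff ℝ ∞ Φ ∧ ∀ y : V3, y ≠ 0 → Φ y = f (Real.log ‖y‖)} := by
  obtain ⟨Φ, hΦ, hΦf⟩ := hf
  obtain ⟨Ψ, hΨ, hΨf⟩ := radialExt_div hΦ hΦf
  exact ⟨Ψ, hΨ, hΨf⟩

/-- For an `s`-type function (`eˣ s ∈ 𝓔`): `s` is smooth. [folklore] -/
theorem sType_smooth {s : ℝ → ℝ} (hs : (fun x => Real.exp x * s x) ∈ {f : ℝ → ℝ | ∃ Φ : V3 → ℝ, ContDiff ℝ ∞ Φ ∧ ∀ y : V3, y ≠ 0 → Φ y = f (Real.log ‖y‖)}) : ContDiff ℝ ∞ s := by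
  have h := radial_smooth hs
  have e : s = fun x => Real.exp (-x) * (Real.exp x * s x) := by
    funext x; rw [← mul_assoc, ← Real.exp_add]; simp
  rw [e]
  exact (Real.contDiff_exp.comp contDiff_neg).mul h

/-- For an `s`-type function: `eˣ s′ = (eˣ s)′ − eˣ s ∈ 𝓔`. [folklore] -/
theorem sType_exp_deriv {s : ℝ → ℝ} (hs : (fun x => Real.exp x * s x) ∈ {f : ℝ → ℝ | ∃ Φ : V3 → ℝ, ContDiff ℝ ∞ Φ ∧ ∀ y : V3, y ≠ 0 → Φ y = f (Real.log ‖y‖)}) :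
    (fun x => Real.exp x * deriv s x) ∈ {f : ℝ → ℝ | ∃ Φ : V3 → ℝ, ContDiff ℝ ∞ Φ ∧ ∀ y : V3, y ≠ 0 → Φ y = f (Real.log ‖y‖)} := by
  have hsd : Differentiable ℝ s := (sType_smooth hs).differentiable (by simp)
  have h := radial_sub (radial_deriv hs) hs
  have e : (fun x => Real.exp x * deriv s x) =
      fun x => deriv (fun x => Real.exp x * s x) x - Real.exp x * s x := by
    funext x
    have hd : HasDerivAt (fun x => Real.exp x * s x) (Real.exp x * s x + Real.exp x * deriv s x) x :=
      (Real.hasDerivAt_exp x).mul (hsd x).hasDerivAt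
    rw [hd.deriv]; ring
  rw [e]; exact h

/-- THE PRESSURE TERMS ARE REGULAR: for `s`-type `a, b`, `a (b′ + b) = (eˣ a) · e^{−2x} (eˣ b)′ ∈ 𝓔`. [folklore] -/
theorem sType_pressure {a b : ℝ → ℝ} (ha : (fun x => Real.exp x * a x) ∈ {f : ℝ → ℝ | ∃ Φ : V3 → ℝ, ContDiff ℝ ∞ Φ ∧ ∀ y : V3, y ≠ 0 → Φ y = f (Real.log ‖y‖)})
    (hb : (fun x => Real.exp x * b x) ∈ {f : ℝ → ℝ | ∃ Φ : V3 → ℝ, ContDiff ℝ ∞ Φ ∧ ∀ y : V3, y ≠ 0 → Φ y = f (Real.log ‖y‖)}) :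
    (fun x => a x * (deriv b x + b x)) ∈ {f : ℝ → ℝ | ∃ Φ : V3 → ℝ, ContDiff ℝ ∞ Φ ∧ ∀ y : V3, y ≠ 0 → Φ y = f (Real.log ‖y‖)} := by
  have hbd : Differentiable ℝ b := (sType_smooth hb).differentiable (by simp)
  have h := radial_mul ha (radial_div hb)
  have e : (fun x => a x * (deriv b x + b x)) =
      fun x => (Real.exp x * a x) * (Real.exp (-2 * x) * deriv (fun x => Real.exp x * b x) x) := by
    funext x
    have hd : HasDerivAt (fun x => Real.exp x * b x) (Real.exp x * b x + Real.exp x * deriv b x) x :=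
      (Real.hasDerivAt_exp x).mul (hbd x).hasDerivAt
    rw [hd.deriv]
    have h3 : Real.exp x * Real.exp (-2 * x) * Real.exp x = 1 := by
      rw [← Real.exp_add, ← Real.exp_add, ← Real.exp_zero]
      congr 1; ring
    linear_combination (-(a x * (deriv b x + b x))) * h3
  rw [e]; exact h

/-- Powers of the `s`-series have `𝓔`-coefficients after weighting: if `eˣ sc n ∈ 𝓔` for `n ≤ d`, then
`x ↦ e^{Nx} [G^d](Σ_n sc n(x) Gⁿ)^N ∈ 𝓔` (induction on `N`, Cauchy product). [folklore] -/
theorem sType_powCoeff (sc : ℕ → ℝ → ℝ) :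
    ∀ (N d : ℕ), (∀ n, n ≤ d → (fun x => Real.exp x * sc n x) ∈ {f : ℝ → ℝ | ∃ Φ : V3 → ℝ, ContDiff ℝ ∞ Φ ∧ ∀ y : V3, y ≠ 0 → Φ y = f (Real.log ‖y‖)}) →
      (fun x => Real.exp x ^ N * PowerSeries.coeff d ((PowerSeries.mk fun n => sc n x) ^ N)) ∈ {f : ℝ → ℝ | ∃ Φ : V3 → ℝ, ContDiff ℝ ∞ Φ ∧ ∀ y : V3, y ≠ 0 → Φ y = f (Real.log ‖y‖)} := by
  intro N
  induction N with
  | zero =>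
    intro d _
    simp only [pow_zero, one_mul, coeff_one]
    exact radial_const _
  | succ N ih =>
    intro d hd
    have e : (fun x => Real.exp x ^ (N + 1) * PowerSeries.coeff d ((PowerSeries.mk fun n => sc n x) ^ (N + 1))) =
        fun x => ∑ p ∈ Finset.HasAntidiagonal.antidiagonal d,
          (Real.exp x ^ N * PowerSeries.coeff p.1 ((PowerSeries.mk fun n => sc n x) ^ N)) *
            (Real.exp x * sc p.2 x) := by
      funext x
      rw [pow_succ, pow_succ, coeff_mul, Finset.mul_sum]
      refine Finset.sum_congr rfl fun p _ => ?_
      rw [coeff_mk]; ring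
    rw [e]
    refine radial_sum _ fun p hp => ?_
    have hp2 : p.2 ≤ d := by
      have := Finset.HasAntidiagonal.mem_antidiagonal.mp hp; omega
    have hp1 : p.1 ≤ d := by
      have := Finset.HasAntidiagonal.mem_antidiagonal.mp hp; omega
    exact radial_mul (ih p.1 fun n hn => hd n (hn.trans hp1)) (hd p.2 hp2)

/-- THE STIFFENING COEFFICIENTS ARE IN `𝓔`: for `1 ≤ c ≤ k` (so that only `sc n`, `n < k`, enter the `j ≥ 1` terms) and
any jet `m`, `Mc c = Σ_{j ≤ c} m_j e^{3jx} [G^{c−j}](Σ sc n Gⁿ)^{3j} ∈ 𝓔`. [folklore] -/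
theorem radial_Mc {sc : ℕ → ℝ → ℝ} {m : ℕ → ℝ} {k c : ℕ}
    (hsc : ∀ n, n < k → (fun x => Real.exp x * sc n x) ∈ {f : ℝ → ℝ | ∃ Φ : V3 → ℝ, ContDiff ℝ ∞ Φ ∧ ∀ y : V3, y ≠ 0 → Φ y = f (Real.log ‖y‖)}) (hc1 : 1 ≤ c) (hck : c ≤ k) :
    (fun x => ∑ j ∈ Finset.range (c + 1), m j * Real.exp (3 * x) ^ j *
      PowerSeries.coeff (c - j) ((PowerSeries.mk fun n => sc n x) ^ (3 * j))) ∈ {f : ℝ → ℝ | ∃ Φ : V3 → ℝ, ContDiff ℝ ∞ Φ ∧ ∀ y : V3, y ≠ 0 → Φ y = f (Real.log ‖y‖)} := by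
  have e : (fun x => ∑ j ∈ Finset.range (c + 1), m j * Real.exp (3 * x) ^ j *
      PowerSeries.coeff (c - j) ((PowerSeries.mk fun n => sc n x) ^ (3 * j))) =
      fun x => m 0 * (if c = 0 then 1 else 0) + ∑ j ∈ Finset.Ico 1 (c + 1), m j *
        (Real.exp x ^ (3 * j) * PowerSeries.coeff (c - j) ((PowerSeries.mk fun n => sc n x) ^ (3 * j))) := by
    funext x
    rw [Finset.range_eq_Ico, Finset.sum_eq_sum_Ico_succ_bot (by omega : 0 < c + 1)]
    simp only [mul_zero, pow_zero, mul_one, Nat.sub_zero, coeff_one]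
    congr 1
    refine Finset.sum_congr rfl fun j _ => ?_
    have h3 : Real.exp (3 * x) = Real.exp x ^ 3 := by
      rw [← Real.exp_nat_mul]; norm_num
    rw [h3, ← pow_mul]; ring
  rw [e]
  refine radial_add (radial_const _) (radial_sum _ fun j hj => radial_const_mul _ ?_)
  have hj := Finset.mem_Ico.mp hj
  exact sType_powCoeff sc (3 * j) (c - j) fun n hn => hsc n (by omega)

/-! ## The sources are regular pairs -/

/-- Unpacking `isRegularPair_iff_radial` into `𝓔`-memberships: `u₁ ∈ 𝓔` and `eˣ u₂ ∈ 𝓔`. [folklore] -/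
theorem radial_of_isRegularPair {u₁ u₂ : ℝ → ℝ} (h : IsRegularPair (fun x => (u₁ x : ℂ)) (fun x => (u₂ x : ℂ))) :
    u₁ ∈ {f : ℝ → ℝ | ∃ Φ : V3 → ℝ, ContDiff ℝ ∞ Φ ∧ ∀ y : V3, y ≠ 0 → Φ y = f (Real.log ‖y‖)} ∧ (fun x => Real.exp x * u₂ x) ∈ {f : ℝ → ℝ | ∃ Φ : V3 → ℝ, ContDiff ℝ ∞ Φ ∧ ∀ y : V3, y ≠ 0 → Φ y = f (Real.log ‖y‖)} := by
  obtain ⟨h1, Ψ, hΨ, hΨu⟩ := (isRegularPair_iff_radial u₁ u₂).mp h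
  refine ⟨h1, Ψ, hΨ, fun y hy => ?_⟩
  show Ψ y = Real.exp (Real.log ‖y‖) * u₂ (Real.log ‖y‖)
  rw [hΨu y hy, Real.exp_log (norm_pos_iff.2 hy)]

/-- Packing `𝓔`-memberships into `IsRegularPair`. [folklore] -/
theorem isRegularPair_of_radial {u₁ u₂ : ℝ → ℝ} (h1 : u₁ ∈ {f : ℝ → ℝ | ∃ Φ : V3 → ℝ, ContDiff ℝ ∞ Φ ∧ ∀ y : V3, y ≠ 0 → Φ y = f (Real.log ‖y‖)})
    (h2 : (fun x => Real.exp x * u₂ x) ∈ {f : ℝ → ℝ | ∃ Φ : V3 → ℝ, ContDiff ℝ ∞ Φ ∧ ∀ y : V3, y ≠ 0 → Φ y = f (Real.log ‖y‖)}) :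
    IsRegularPair (fun x => (u₁ x : ℂ)) (fun x => (u₂ x : ℂ)) := by
  obtain ⟨Ψ, hΨ, hΨu⟩ := h2
  refine (isRegularPair_iff_radial u₁ u₂).mpr ⟨h1, Ψ, hΨ, fun y hy => ?_⟩
  have h := hΨu y hy
  simp only [Real.exp_log (norm_pos_iff.2 hy)] at h
  exact h

/-- **THE SOURCES OF THE HIERARCHY ARE CENTRE-REGULAR PAIRS** (registered helper `packingSources_regular` of
`stub_analyticPackingImplosion`): if `(wc j, sc j)` is a regular real pair for every `j < k`, then the order-`k`
sources `(Src_w, Src_s)` of `packingHierarchy_order` — with the stiffening coefficients in the closed form of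
`familyCoeff_stiffening` for an arbitrary jet `m` — form a regular real pair. [folklore] -/
theorem packingSources_regular : ∀ (wc sc : ℕ → ℝ → ℝ) (m : ℕ → ℝ) (Mc : ℕ → ℝ → ℝ) (Sw Ss : ℝ → ℝ) (k : ℕ), (∀ j, j < k → IsRegularPair (fun x => (wc j x : ℂ)) (fun x => (sc j x : ℂ))) → (∀ c x, Mc c x = ∑ j ∈ Finset.range (c + 1), m j * Real.exp (3 * x) ^ j * PowerSeries.coeff (c - j) ((PowerSeries.mk fun n => sc n x) ^ (3 * j))) → (∀ x, Sw x = (∑ i ∈ Finset.Ico 1 k, (wc i x * deriv (wc (k - i)) x + wc i x * wc (k - i) x + 3 * (sc i x * (deriv (sc (k - i)) x + sc (k - i) x)))) + 3 * ∑ p ∈ Finset.range k, (∑ i ∈ Finset.range (p + 1), sc i x * (deriv (sc (p - i)) x + sc (p - i) x)) * Mc (k - p) x) → (∀ x, Ss x = ∑ i ∈ Finset.Ico 1 k, (wc i x * deriv (sc (k - i)) x + sc i x / 3 * deriv (wc (k - i)) x + 2 * (sc i x * wc (k - i) x))) → IsRegularPair (fun x => (Sw x : ℂ)) (fun x => (Ss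 x : ℂ)) := by
  intro wc sc m Mc Sw Ss k hreg hMc hSw hSs
  have hw : ∀ j, j < k → wc j ∈ {f : ℝ → ℝ | ∃ Φ : V3 → ℝ, ContDiff ℝ ∞ Φ ∧ ∀ y : V3, y ≠ 0 → Φ y = f (Real.log ‖y‖)} := fun j hj => (radial_of_isRegularPair (hreg j hj)).1
  have hs : ∀ j, j < k → (fun x => Real.exp x * sc j x) ∈ {f : ℝ → ℝ | ∃ Φ : V3 → ℝ, ContDiff ℝ ∞ Φ ∧ ∀ y : V3, y ≠ 0 → Φ y = f (Real.log ‖y‖)} := fun j hj => (radial_of_isRegularPair (hreg j hj)).2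
  -- the `w`-source
  have hSw' : Sw ∈ {f : ℝ → ℝ | ∃ Φ : V3 → ℝ, ContDiff ℝ ∞ Φ ∧ ∀ y : V3, y ≠ 0 → Φ y = f (Real.log ‖y‖)} := by
    have e : Sw = fun x => (∑ i ∈ Finset.Ico 1 k, (wc i x * deriv (wc (k - i)) x + wc i x * wc (k - i) x +
        3 * (sc i x * (deriv (sc (k - i)) x + sc (k - i) x)))) +
        3 * ∑ p ∈ Finset.range k, (∑ i ∈ Finset.range (p + 1), sc i x * (deriv (sc (p - i)) x + sc (p - i) x)) *
          Mc (k - p) x := funext hSw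
    rw [e]
    refine radial_add (radial_sum _ fun i hi => ?_) (radial_const_mul 3 (radial_sum _ fun p hp => ?_))
    · have hi' := Finset.mem_Ico.mp hi
      exact radial_add (radial_add (radial_mul (hw i hi'.2) (radial_deriv (hw (k - i) (by omega))))
        (radial_mul (hw i hi'.2) (hw (k - i) (by omega))))
        (radial_const_mul 3 (sType_pressure (hs i hi'.2) (hs (k - i) (by omega))))
    · have hp' := Finset.mem_range.mp hp
      refine radial_mul (radial_sum _ fun i hi => ?_) ?_
      · have hi' := Finset.mem_range.mp hi
        exact sType_pressure (hs i (by omega)) (hs (p - i) (by omega))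
      · have e2 : (fun x => Mc (k - p) x) = fun x => ∑ j ∈ Finset.range (k - p + 1), m j * Real.exp (3 * x) ^ j *
            PowerSeries.coeff (k - p - j) ((PowerSeries.mk fun n => sc n x) ^ (3 * j)) := funext (hMc (k - p))
        have h := radial_Mc (m := m) hs (by omega : 1 ≤ k - p) (by omega : k - p ≤ k)
        rw [← e2] at h
        exact h
  -- the `s`-source, weighted by `eˣ`
  have hSs' : (fun x => Real.exp x * Ss x) ∈ {f : ℝ → ℝ | ∃ Φ : V3 → ℝ, ContDiff ℝ ∞ Φ ∧ ∀ y : V3, y ≠ 0 → Φ y = f (Real.log ‖y‖)} := by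
    have e : (fun x => Real.exp x * Ss x) = fun x => ∑ i ∈ Finset.Ico 1 k,
        (wc i x * (Real.exp x * deriv (sc (k - i)) x) + 1 / 3 * ((Real.exp x * sc i x) * deriv (wc (k - i)) x) +
          2 * ((Real.exp x * sc i x) * wc (k - i) x)) := by
      funext x
      rw [hSs x, Finset.mul_sum]
      refine Finset.sum_congr rfl fun i _ => ?_
      ring
    rw [e]
    refine radial_sum _ fun i hi => ?_
    have hi' := Finset.mem_Ico.mp hi
    exact radial_add (radial_add (radial_mul (hw i hi'.2) (sType_exp_deriv (hs (k - i) (by omega))))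
      (radial_const_mul _ (radial_mul (hs i hi'.2) (radial_deriv (hw (k - i) (by omega))))))
      (radial_const_mul _ (radial_mul (hs i hi'.2) (hw (k - i) (by omega))))
  exact isRegularPair_of_radial hSw' hSs'

end Summit.AtomisticToContinuum.HydrodynamicLimit.Theorems.PackingAnalyticImplosion

end
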